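import Mathlib
import Summits.Ventures.PercRepro2.HCov
import Summits.Ventures.PercRepro2.BasePendant
import Summits.Ventures.PercRepro2.PendantRoot

/-!
# A ROOT as a leaf at `a₃`, part 1: the two worlds of the leaf edge and the `Q` / `PD` atoms
(blind cell PercRepro2, p4 g0; S3 GAP (G4), proofs/subclaims/S3-CLASSES.md §S3.4 (e))

The root `a₁` is a LEAF attached to `a₃` by the single edge `f` (`q = p f`), `a₂ ≠ a₁`.  On
`{f closed}` the root is isolated (`Q` sure, `C₁ = {a₁}`, `PD = Q¹ := {a₃ ↮ a₂}`, `T = {a₂ ↔ a₃}`,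
`T′ = ∅`); on `{f open}` the root is `a₃` (`Q = Q¹`, `PD = T = ∅`, `T′ = Q¹`).  `prob_split` turns
these pointwise facts into the `q`-mixture of every mass; this file does the `Q`- and `PD`-masses,
`RootLeafA3Atoms.lean` the `T`/`T′`-masses, `RootLeafA3.lean` the identity and the theorem.
-/

namespace Summit.Ventures.PercRepro2

open UnionCluster CovForm PendantRoot

namespace RootLeafA3

variable {V : Type*} {E : Type*} [Fintype E] [DecidableEq E] {R : Type*} [Field R]
  [LinearOrder R] [IsStrictOrderedRing R]

/-! ## The two worlds of the leaf edge, pointwise -/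

section Pointwise

variable {ends : E → Sym2 V} {f : E} {a₁ a₃ : V}

omit [Fintype E] [DecidableEq E] in
/-- On `{f open}`, `a₁` connects exactly as `a₃` does (left argument). -/
lemma mem_connL_open (hf : ends f = s(a₁, a₃)) (v : V) {ω : Config E} (hω : ω f = true) :
    ω ∈ connEvent ends a₁ v ↔ ω ∈ connEvent ends a₃ v := by
  simp only [mem_connEvent]
  exact conn_leaf_open hf hω

omit [Fintype E] [DecidableEq E] in
/-- On `{f open}`, `a₁` connects exactly as `a₃` does (right argument). -/
lemma mem_connR_open (hf : ends f = s(a₁, a₃)) (v : V) {ω : Config E} (hω : ω f = true) :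
    ω ∈ connEvent ends v a₁ ↔ ω ∈ connEvent ends v a₃ := by
  rw [connEvent_comm ends v a₁, connEvent_comm ends v a₃]
  exact mem_connL_open hf v hω

omit [Fintype E] [DecidableEq E] in
/-- On `{f closed}`, the leaf `a₁` is isolated (left argument). -/
lemma mem_connL_closed (hf : ends f = s(a₁, a₃)) (hleaf : ∀ e, a₁ ∈ ends e → e = f)
    (h13 : a₁ ≠ a₃) {v : V} (hv : v ≠ a₁) {ω : Config E} (hω : ω f = false) :
    ω ∉ connEvent ends a₁ v :=
  fun h => hv (conn_leaf_closed hf hleaf h13 hω h)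

omit [Fintype E] [DecidableEq E] in
/-- On `{f closed}`, the leaf `a₁` is isolated (right argument). -/
lemma mem_connR_closed (hf : ends f = s(a₁, a₃)) (hleaf : ∀ e, a₁ ∈ ends e → e = f)
    (h13 : a₁ ≠ a₃) {v : V} (hv : v ≠ a₁) {ω : Config E} (hω : ω f = false) :
    ω ∉ connEvent ends v a₁ :=
  fun h => hv (conn_leaf_closed hf hleaf h13 hω (conn_symm h))

omit [Fintype E] [DecidableEq E] in
/-- `Q = {a₁ ↮ a₂}` on `{f open}` is `Q¹ = {a₃ ↮ a₂}`. -/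
lemma mem_Q_open (hf : ends f = s(a₁, a₃)) (a₂ : V) {ω : Config E} (hω : ω f = true) :
    ω ∈ avoidAll ends a₂ {a₁} ↔ ω ∈ avoidAll ends a₂ {a₃} := by
  rw [avoidAll_eq_compl, avoidAll_eq_compl, Set.mem_compl_iff, Set.mem_compl_iff,
    mem_connL_open hf a₂ hω]

omit [Fintype E] [DecidableEq E] in
/-- `Q` is sure on `{f closed}`. -/
lemma mem_Q_closed (hf : ends f = s(a₁, a₃)) (hleaf : ∀ e, a₁ ∈ ends e → e = f) (h13 : a₁ ≠ a₃)
    {a₂ : V} (h12 : a₁ ≠ a₂) {ω : Config E} (hω : ω f = false) :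
    ω ∈ avoidAll ends a₂ {a₁} := by
  rw [avoidAll_eq_compl, Set.mem_compl_iff]
  exact mem_connL_closed hf hleaf h13 (Ne.symm h12) hω

omit [Fintype E] [DecidableEq E] in
/-- `PD` is empty on `{f open}` (`a₃ ∈ C₁`). -/
lemma mem_PD_open (hf : ends f = s(a₁, a₃)) (a₂ : V) {ω : Config E} (hω : ω f = true) :
    ω ∉ PDEvent ends a₁ a₂ a₃ := by
  rintro ⟨_, h⟩
  exact h (Or.inl (conn_symm ((mem_connL_open hf a₃ hω).2 (conn_refl ends ω a₃))))

omit [Fintype E] [DecidableEq E] in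
/-- `PD = Q¹` on `{f closed}`. -/
lemma mem_PD_closed (hf : ends f = s(a₁, a₃)) (hleaf : ∀ e, a₁ ∈ ends e → e = f) (h13 : a₁ ≠ a₃)
    {a₂ : V} (h12 : a₁ ≠ a₂) {ω : Config E} (hω : ω f = false) :
    ω ∈ PDEvent ends a₁ a₂ a₃ ↔ ω ∈ avoidAll ends a₂ {a₃} := by
  have h1 := mem_connL_closed hf hleaf h13 (Ne.symm h12) hω
  have h2 := mem_connR_closed hf hleaf h13 h13.symm hω
  simp only [PDEvent, Dtilde, inU, Set.mem_inter_iff, Set.mem_compl_iff, Set.mem_union,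
    avoidAll_eq_compl, h1, h2, false_or, not_false_eq_true, true_and]

omit [Fintype E] [DecidableEq E] in
/-- `T = {a₁ ∉ C₂, a₃ ∈ C₂}` is empty on `{f open}`. -/
lemma mem_T_open (hf : ends f = s(a₁, a₃)) (a₂ : V) {ω : Config E} (hω : ω f = true) :
    ω ∉ TEvent ends a₁ a₂ a₃ := by
  rintro ⟨h1, h2⟩
  exact h1 ((mem_connR_open hf a₂ hω).2 h2)

omit [Fintype E] [DecidableEq E] in
/-- `T = {a₂ ↔ a₃}` on `{f closed}`. -/
lemma mem_T_closed (hf : ends f = s(a₁, a₃)) (hleaf : ∀ e, a₁ ∈ ends e → e = f) (h13 : a₁ ≠ a₃)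
    {a₂ : V} (h12 : a₁ ≠ a₂) {ω : Config E} (hω : ω f = false) :
    ω ∈ TEvent ends a₁ a₂ a₃ ↔ ω ∈ connEvent ends a₂ a₃ := by
  have h1 := mem_connR_closed hf hleaf h13 (Ne.symm h12) hω
  simp only [TEvent, Set.mem_inter_iff, Set.mem_compl_iff, h1, not_false_eq_true, true_and]

omit [Fintype E] [DecidableEq E] in
/-- `T′ = {a₂ ∉ C₁, a₃ ∈ C₁} = Q¹` on `{f open}`. -/
lemma mem_T'_open (hf : ends f = s(a₁, a₃)) (a₂ : V) {ω : Config E} (hω : ω f = true) :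
    ω ∈ TEvent ends a₂ a₁ a₃ ↔ ω ∈ avoidAll ends a₂ {a₃} := by
  simp only [TEvent, Set.mem_inter_iff, Set.mem_compl_iff, mem_connL_open hf a₂ hω,
    mem_connL_open hf a₃ hω, avoidAll_eq_compl]
  simp only [mem_connEvent, conn_refl, and_true]

omit [Fintype E] [DecidableEq E] in
/-- `T′` is empty on `{f closed}`. -/
lemma mem_T'_closed (hf : ends f = s(a₁, a₃)) (hleaf : ∀ e, a₁ ∈ ends e → e = f) (h13 : a₁ ≠ a₃)
    (a₂ : V) {ω : Config E} (hω : ω f = false) :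
    ω ∉ TEvent ends a₂ a₁ a₃ :=
  fun h => mem_connL_closed hf hleaf h13 h13.symm hω h.2

end Pointwise

/-! ## The mixture of the two worlds -/

section Split

variable (p : E → R) {ends : E → Sym2 V} {f : E}

omit [LinearOrder R] [IsStrictOrderedRing R] in
/-- A mass is the `q`-mixture of its two world values when the event agrees with a free event on
each side of the leaf edge. -/
lemma prob_split {A A₁ A₀ : Set (Config E)} (hA₁ : Free f A₁) (hA₀ : Free f A₀)
    (h₁ : A ∩ openEdge f = A₁ ∩ openEdge f) (h₀ : A ∩ closedEdge f = A₀ ∩ closedEdge f) :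
    prob p A = p f * prob p A₁ + (1 - p f) * prob p A₀ := by
  have h := prob_inter_add_prob_inter_compl p A (openEdge f)
  rw [← closedEdge_eq_compl, h₁, h₀, prob_inter_openEdge_of_free p hA₁,
    prob_inter_closedEdge_of_free p hA₀] at h
  linear_combination -h

end Split

/-! ## The atoms of `Gc` -/

section Atoms

variable (p : E → R) {ends : E → Sym2 V} {f : E} {a₁ a₃ : V} (hf : ends f = s(a₁, a₃))
  (hleaf : ∀ e, a₁ ∈ ends e → e = f) (h13 : a₁ ≠ a₃) {a₂ : V} (h12 : a₁ ≠ a₂)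

include hf hleaf h13 h12

omit [Fintype E] [DecidableEq E] in
/-- `Q¹ = {a₃ ↮ a₂}` is free of the leaf edge. -/
lemma free_Q1 : Free f (avoidAll ends a₂ {a₃}) := by
  rw [avoidAll_eq_compl]
  exact (free_connEvent hf hleaf h13 h13.symm (Ne.symm h12)).compl

omit [LinearOrder R] [IsStrictOrderedRing R] in
/-- `P(Q) = q Z + (1 − q)`. -/
lemma prob_Q : prob p (avoidAll ends a₂ {a₁}) =
    p f * prob p (avoidAll ends a₂ {a₃}) + (1 - p f) * prob p Set.univ := by
  refine prob_split p (free_Q1 hf hleaf h13 h12)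
    (by intro ω ω' _; rfl) ?_ ?_
  · ext ω
    simp only [Set.mem_inter_iff, mem_openEdge]
    constructor <;> rintro ⟨h, hω⟩ <;> exact ⟨by simpa only [mem_Q_open hf a₂ hω] using h, hω⟩
  · ext ω
    simp only [Set.mem_inter_iff, mem_closedEdge, Set.mem_univ, true_and, and_iff_right_iff_imp]
    exact fun hω => mem_Q_closed hf hleaf h13 h12 hω

omit [LinearOrder R] [IsStrictOrderedRing R] in
/-- `P(Q ∩ X) = q P(Q¹ ∩ X) + (1 − q) P(X)` for free `X`. -/
lemma prob_Q_inter {X : Set (Config E)} (hX : Free f X) :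
    prob p (avoidAll ends a₂ {a₁} ∩ X) =
      p f * prob p (avoidAll ends a₂ {a₃} ∩ X) + (1 - p f) * prob p X := by
  refine prob_split p ((free_Q1 hf hleaf h13 h12).inter hX) hX
    ?_ ?_
  · ext ω
    simp only [Set.mem_inter_iff, mem_openEdge]
    constructor <;> rintro ⟨h, hω⟩ <;> exact ⟨by simpa only [mem_Q_open hf a₂ hω] using h, hω⟩
  · ext ω
    simp only [Set.mem_inter_iff, mem_closedEdge]
    constructor <;> rintro ⟨h, hω⟩
    · exact ⟨h.2, hω⟩
    · exact ⟨⟨mem_Q_closed hf hleaf h13 h12 hω, h⟩, hω⟩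

omit [LinearOrder R] [IsStrictOrderedRing R] in
/-- `P(Q ∩ {a₁ ↔ v} ∩ X) = q P(Q¹ ∩ {a₃ ↔ v} ∩ X)` for free `X` and `v ≠ a₁`. -/
lemma prob_Q_inter_L {v : V} (hv : v ≠ a₁) {X : Set (Config E)} (hX : Free f X) :
    prob p (avoidAll ends a₂ {a₁} ∩ (connEvent ends a₁ v ∩ X)) =
      p f * prob p (avoidAll ends a₂ {a₃} ∩ (connEvent ends a₃ v ∩ X)) := by
  have h := prob_split p (A := avoidAll ends a₂ {a₁} ∩ (connEvent ends a₁ v ∩ X))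
    ((free_Q1 hf hleaf h13 h12).inter
      ((free_connEvent hf hleaf h13 h13.symm hv).inter hX)) (A₀ := ∅) (by intro ω ω' _; rfl) ?_ ?_
  · rw [h, prob_empty, mul_zero, add_zero]
  · ext ω
    simp only [Set.mem_inter_iff, mem_openEdge]
    constructor <;> rintro ⟨h, hω⟩ <;>
      exact ⟨by simpa only [mem_Q_open hf a₂ hω, mem_connL_open hf v hω] using h, hω⟩
  · ext ω
    simp only [Set.mem_inter_iff, mem_closedEdge, Set.mem_empty_iff_false, false_and,
      iff_false, not_and]
    intro h hω
    exact mem_connL_closed hf hleaf h13 hv hω h.2.1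

omit [LinearOrder R] [IsStrictOrderedRing R] in
/-- `P(Q ∩ X ∩ {a₁ ↔ v}) = q P(Q¹ ∩ X ∩ {a₃ ↔ v})` for free `X` and `v ≠ a₁`. -/
lemma prob_Q_inter_R {v : V} (hv : v ≠ a₁) {X : Set (Config E)} (hX : Free f X) :
    prob p (avoidAll ends a₂ {a₁} ∩ (X ∩ connEvent ends a₁ v)) =
      p f * prob p (avoidAll ends a₂ {a₃} ∩ (X ∩ connEvent ends a₃ v)) := by
  rw [Set.inter_comm X, Set.inter_comm X]
  exact prob_Q_inter_L p hf hleaf h13 h12 hv hX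

omit [LinearOrder R] [IsStrictOrderedRing R] in
/-- `P(Q ∩ {a₁ ↔ v}) = q P(Q¹ ∩ {a₃ ↔ v})`. -/
lemma prob_Q_inter_L₀ {v : V} (hv : v ≠ a₁) :
    prob p (avoidAll ends a₂ {a₁} ∩ connEvent ends a₁ v) =
      p f * prob p (avoidAll ends a₂ {a₃} ∩ connEvent ends a₃ v) := by
  have h := prob_Q_inter_L p hf hleaf h13 h12 hv (X := Set.univ) (by intro ω ω' _; rfl)
  simpa only [Set.inter_univ] using h

omit [LinearOrder R] [IsStrictOrderedRing R] in
/-- `P(PD ∩ X) = (1 − q) P(Q¹ ∩ X)` for free `X`. -/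
lemma prob_PD_inter {X : Set (Config E)} (hX : Free f X) :
    prob p (PDEvent ends a₁ a₂ a₃ ∩ X) = (1 - p f) * prob p (avoidAll ends a₂ {a₃} ∩ X) := by
  have h := prob_split p (A := PDEvent ends a₁ a₂ a₃ ∩ X) (A₁ := ∅) (by intro ω ω' _; rfl)
    ((free_Q1 hf hleaf h13 h12).inter hX) ?_ ?_
  · rw [h, prob_empty, mul_zero, zero_add]
  · ext ω
    simp only [Set.mem_inter_iff, mem_openEdge, Set.mem_empty_iff_false, false_and, iff_false,
      not_and]
    intro h hω
    exact mem_PD_open hf a₂ hω h.1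
  · ext ω
    simp only [Set.mem_inter_iff, mem_closedEdge]
    constructor <;> rintro ⟨h, hω⟩ <;>
      exact ⟨by simpa only [mem_PD_closed hf hleaf h13 h12 hω] using h, hω⟩

omit [LinearOrder R] [IsStrictOrderedRing R] in
/-- `P(PD) = (1 − q) Z`. -/
lemma prob_PD : prob p (PDEvent ends a₁ a₂ a₃) = (1 - p f) * prob p (avoidAll ends a₂ {a₃}) := by
  have h := prob_PD_inter p hf hleaf h13 h12 (X := Set.univ) (by intro ω ω' _; rfl)
  simpa only [Set.inter_univ] using h

omit [LinearOrder R] [IsStrictOrderedRing R] h12 in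
/-- `P(PD ∩ {a₁ ↔ v} ∩ X) = 0` (`v ≠ a₁`). -/
lemma prob_PD_inter_L {v : V} (hv : v ≠ a₁) (X : Set (Config E)) :
    prob p (PDEvent ends a₁ a₂ a₃ ∩ (connEvent ends a₁ v ∩ X)) = 0 := by
  have h := prob_split p (f := f) (A := PDEvent ends a₁ a₂ a₃ ∩ (connEvent ends a₁ v ∩ X)) (A₁ := ∅)
    (A₀ := ∅) (by intro ω ω' _; rfl) (by intro ω ω' _; rfl) ?_ ?_
  · rw [h, prob_empty]; ring
  · ext ω
    simp only [Set.mem_inter_iff, mem_openEdge, Set.mem_empty_iff_false, false_and, iff_false,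
      not_and]
    intro h hω
    exact mem_PD_open hf a₂ hω h.1
  · ext ω
    simp only [Set.mem_inter_iff, mem_closedEdge, Set.mem_empty_iff_false, false_and, iff_false,
      not_and]
    intro h hω
    exact mem_connL_closed hf hleaf h13 hv hω h.2.1

omit [LinearOrder R] [IsStrictOrderedRing R] h12 in
/-- `P(PD ∩ X ∩ {a₁ ↔ v}) = 0` (`v ≠ a₁`). -/
lemma prob_PD_inter_R {v : V} (hv : v ≠ a₁) (X : Set (Config E)) :
    prob p (PDEvent ends a₁ a₂ a₃ ∩ (X ∩ connEvent ends a₁ v)) = 0 := by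
  rw [Set.inter_comm X]
  exact prob_PD_inter_L p hf hleaf h13 hv X

omit [LinearOrder R] [IsStrictOrderedRing R] h12 in
/-- `P(PD ∩ {a₁ ↔ v}) = 0`. -/
lemma prob_PD_inter_L₀ {v : V} (hv : v ≠ a₁) :
    prob p (PDEvent ends a₁ a₂ a₃ ∩ connEvent ends a₁ v) = 0 := by
  have h := prob_PD_inter_L p hf hleaf h13 (a₂ := a₂) hv Set.univ
  simpa only [Set.inter_univ] using h

end Atoms

end RootLeafA3

end Summit.Ventures.PercRepro2
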